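import Mathlib
import HarnessLib
import Literature.Analysis.FluidPDE.NSCriticalClosureBesovKatoClass

/-!
# RootDecompAxisLogGauge — crux `LogGaugeCriterion` (stmt-NavierStokesRegularity-25378), stub `stub_extension_of_locallyBounded`

Registered stub (writer g10 BC3 skeleton `Lines/birth.lean` of the LOG-GAUGE CRITERION, 2026-08-30; «continuation
bookkeeping, M, in print»), PROVED here verbatim: a classical Navier–Stokes solution on `ℝ³ × [0,T)`, Leray–Hopf from
its rapidly decaying datum, which is LOCALLY BOUNDED near the terminal time at every point — every `x₀` has a backward
parabolic neighbourhood `(T − ρ², T) × B_ρ(x₀)`, `ρ > 0`, on which `‖u‖ ≤ M` — extends smoothly past `T`.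

Proof: the tree's PROVED continuation theorem «no singular point at time `T` ⇒ extension»
`Literature.Analysis.FluidPDE.hasSmoothExtensionPast_of_forall_exists_parabolicCylinder` (Lemarié-Rieusset 2016
Thm 15.1 (C): the classical solution is a Kato `C_t L³` solution with the far-field `L^∞` bound, so a finite maximal
time carries a point `x₀` with `u ∉ L^∞(Q_r(T,x₀))` for every `r`; Albritton 2018 Cor 4.6 / Rusin–Šverák 2011 §4)
asks exactly for one backward cylinder `Q_r(T,x₀) = (T − r², T) × B_r(x₀)` per point on which `u` is essentially
bounded; the pointwise bound `M` on `Q_ρ(T,x₀)` gives `‖u‖_{L^∞(Q_ρ(T,x₀))} ≤ M < ∞`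
(`eLpNormEssSup_le_of_ae_bound` on the restricted measure). With this stub closed the LOG-GAUGE CRITERION reduces,
kernel-checked (`LogGaugeCriterion_of` of the registered skeleton), to its mathematical stub
`stub_logGaugePointBounded` (Lei–Ren 2024 question, L). Navier–Stokes regularity is NOT proved by anything here
(rung 0). decomp-ns writer g13.
[cite: LemarieRieusset2016, Thm. 15.1 (C); Albritton2018, Cor. 4.6]
-/

-- the summit and its single sub-problem share the name (CONVENTIONS §1), as in every Theorems file
set_option linter.dupNamespace false

open MeasureTheory Set Filter Topology Function
open scoped ENNReal

namespace Summit.NavierStokesRegularity.NavierStokesRegularity.Theorems.LogGaugeCriterion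

open Literature.Analysis.FluidPDE

/-- A pointwise bound on the backward parabolic cylinder `Q_ρ(T, x₀) = (T − ρ², T) × B_ρ(x₀)` bounds the
`L^∞` norm of `uncurry u` for the measure restricted to the cylinder. [folklore] -/
theorem eLpNorm_top_parabolicCylinder_lt_top_of_bound {T ρ M : ℝ}
    {u : ℝ → EuclideanSpace ℝ (Fin 3) → EuclideanSpace ℝ (Fin 3)} {x₀ : EuclideanSpace ℝ (Fin 3)}
    (hb : ∀ t ∈ Set.Ioo (T - ρ ^ 2) T, ∀ x ∈ Metric.ball x₀ ρ, ‖u t x‖ ≤ M) :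
    eLpNorm (uncurry u) ∞ (volume.restrict (parabolicCylinder ρ ((T : ℝ), x₀))) < ∞ := by
  have hmeas : MeasurableSet (parabolicCylinder ρ ((T : ℝ), x₀)) :=
    (isOpen_parabolicCylinder ρ ((T : ℝ), x₀)).measurableSet
  have hae : ∀ᵐ z ∂(volume.restrict (parabolicCylinder ρ ((T : ℝ), x₀))), ‖uncurry u z‖ ≤ M := by
    rw [ae_restrict_iff' hmeas]
    refine Filter.Eventually.of_forall fun z hz => ?_
    rw [mem_parabolicCylinder] at hz
    obtain ⟨⟨h1, h2⟩, h3⟩ := hz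
    exact hb z.1 ⟨h1, h2⟩ z.2 (Metric.mem_ball.2 h3)
  calc eLpNorm (uncurry u) ∞ (volume.restrict (parabolicCylinder ρ ((T : ℝ), x₀)))
      ≤ ENNReal.ofReal M := by
        rw [eLpNorm_exponent_top]
        exact eLpNormEssSup_le_of_ae_bound hae
    _ < ∞ := ENNReal.ofReal_lt_top

/-- **Registered stub `stub_extension_of_locallyBounded` of crux `LogGaugeCriterion`
(stmt-NavierStokesRegularity-25378), verbatim**: local boundedness near `(T, x₀)` at every `x₀` ⇒ smooth
extension past `T`, for classical Leray–Hopf solutions from rapidly decaying data.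
[cite: LemarieRieusset2016, Thm. 15.1 (C); Albritton2018, Cor. 4.6] -/
theorem stub_extension_of_locallyBounded : ∀ (ν T : ℝ), 0 < ν → 0 < T → ∀ (u : ℝ → EuclideanSpace ℝ (Fin 3) → EuclideanSpace ℝ (Fin 3)) (p : ℝ → EuclideanSpace ℝ (Fin 3) → ℝ), Literature.Analysis.FluidPDE.IsClassicalNSSolutionOn (Set.Ico 0 T) ν 0 u p → Literature.Analysis.FluidPDE.IsLerayHopfOn T ν 0 (u 0) u → Literature.Analysis.FluidPDE.HasRapidSpatialDecay (u 0) → (∀ x₀ : EuclideanSpace ℝ (Fin 3), ∃ ρ M : ℝ, 0 < ρ ∧ ∀ t ∈ Set.Ioo (T - ρ ^ 2) T, ∀ x ∈ Metric.ball x₀ ρ, ‖u t x‖ ≤ M) → Literature.Analysis.FluidPDE.HasSmoothExtensionPast ν 0 u T := by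
  intro ν T hν hT u p hsol hLH h₀ hloc
  refine hasSmoothExtensionPast_of_forall_exists_parabolicCylinder hν hT hsol hLH h₀ fun x₀ => ?_
  obtain ⟨ρ, M, hρ, hb⟩ := hloc x₀
  exact ⟨ρ, hρ, eLpNorm_top_parabolicCylinder_lt_top_of_bound hb⟩

end Summit.NavierStokesRegularity.NavierStokesRegularity.Theorems.LogGaugeCriterion
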